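import Summits.QuantumAdvantage.QuantumAdvantage.Theorems.CubicForrelationNearExactIsExactFourteenLevelSixPrep

/-!
# Crux `CubicForrelation.NearExactIsExact` (stmt-QuantumAdvantage-14043) — n = 14, TWO-SIDED: the level-6 boundary configuration
  `Φ = 31/32` is NOT realizable

Certificate seat `b2b-cforr-cert` (gen 4).  HONEST FRAMING: a theorem about cubic Boolean functions on 14 bits (the finite slice `n = 14`
of the crux) — the first TWO-SIDED exclusion above the certified one-sided ladder; NOT summit progress.

Setting: `f, g : 𝔽₂¹⁴ → 𝔽₂` cubic, `W_g = 32·u` (Ax).  The one-sided tower gives `Φ(f,g) > 31/32 ⇒ Φ = 1` (`isolation_fourteen`);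
at the boundary `Φ = 31/32` the two-sided budget `Σ_x (u − 4(−1)^f)² = 2¹⁹(1 − Φ) = 2¹⁴` is TIGHT.  This file kills the LEVEL-6 case:
if all `u` are even, `u = 2u'`, and some `u'` is odd, then `Φ(f,g) ≥ 31/32` is impossible (`fl_levelSix_false`).  Proof:
* the parity `p = [u' odd]` is quadratic (tower), non-zero, and the budget `Σ(u' − 2(−1)^f)² ≤ 2¹²` pays `≥ 1` per odd point, while
  `RM(2,14)` gives `#{p} ≥ 2¹²`: so `#{p} = 2¹²` exactly, `u' = 2(−1)^f` off `P = {p}`, `u' = 2(−1)^f ± 1` on `P`, and `P` is a 12-FLAT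
  `x₁ ⊕ V₀` (`qf_flat_of_quadratic`);
* GENERAL FLAT SUMS (`fs_flat_sum_dvd`, `k = 4`): `Σ_ε u(x ⊕ a_ε) ≡ 0 (mod 8)` on the 4-flat `x₁ ⊕ ⟨c, c', d₁, d₂⟩` with `c, c' ∈ V₀` and
  `d₁, d₂, d₁⊕d₂ ∉ V₀`; only the four points of the 2-flat `x₁ ⊕ ⟨c,c'⟩` lie in `P`, so `δ = u' − 2(−1)^f` (`±1` on `P`, `0` off `P`) has
  `δ(x₁)δ(x₁⊕c)δ(x₁⊕c')δ(x₁⊕c⊕c') = 1`: `δ` is a `±`CHARACTER on the coset, hence its transform `δ̂` takes values in `{0, ±2¹²}` with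
  `Σ δ̂² = 2²⁶` (four frequencies);
* FOURIER: `δ̂ = 256(−1)^g − 2W_f` (Walsh inversion), and Parseval for `f` forces `Σ_y (−1)^{g(y)} δ̂(y) = 2¹⁷ > 2¹⁴ ≥ Σ|δ̂|`. Contradiction.
The type-O boundary case and the assembly `Φ ≥ 31/32 ⇒ Φ = 1` on 14 bits are the companion file `…FourteenBoundary.lean`.

References: J. Ax (1964) / R. J. McEliece (1972) (Carlet 2021 §4.1); F. J. MacWilliams, N. J. A. Sloane (1977) Ch. 13–15; R. O'Donnell (2014)
§3.3; S. Aaronson, A. Ambainis, SIAM J. Comput. 47 (2018) §1.1.1.  Everything below is proved from Mathlib and the tree; axioms are the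
standard three.
-/

set_option linter.dupNamespace false -- D-0017: single-problem summit ⇒ `QuantumAdvantage.QuantumAdvantage` by design

noncomputable section

namespace Summit.QuantumAdvantage.QuantumAdvantage.Theorems.CubicForrelation.NearExactIsExact

open Finset
open Literature.Computability.QuantumComplexity
open Literature.Computability.QuantumComplexity.BuzetChailloux (bxor zeroVec bxor_bxor_cancel_left bxor_zeroVec zeroVec_bxor bxor_comm
  signOf_sq)
open Literature.Computability.QuantumComplexity.DerivativeWalsh (W sum_W_sq twist_bxor_left sum_char_subspace)

variable {n : ℕ}

/-! ### The level-6 boundary configuration is not realizable -/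

/-- **Level 6 on 14 bits: `Φ ≥ 31/32` is impossible when `W_g ∈ 64ℤ` has an odd quotient somewhere.**  For cubic `f, g : 𝔽₂¹⁴ → 𝔽₂`
with `W_g = 64·u'` and some `u'(x)` odd, `Φ(f,g) < 31/32` — for EVERY Boolean partner `f` (its degree is not used).  (Two-sided: budget + `RM(2,14)` ⇒ the odd set is a 12-flat carrying
`u' = 2(−1)^f ± 1`, `u' = 2(−1)^f` elsewhere; general 4-flat sums ⇒ the sign `u' − 2(−1)^f` is a `±`character of the flat ⇒ four
frequencies `±2¹²`; Walsh inversion + Parseval for `f` need `Σ (−1)^g δ̂ = 2¹⁷`.) [this work] -/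
theorem fl_levelSix_false (f g : (Fin (7 + 7) → Bool) → Bool) (hg : IsDegLeFun 3 g)
    (u' : (Fin (7 + 7) → Bool) → ℤ) (hu' : ∀ x, W (fun y => signOf (g y)) x = (2 : ℝ) ^ 6 * (u' x : ℝ))
    (hodd : ∃ x, Odd (u' x)) (hΦ : (31 / 32 : ℝ) ≤ forrelation f g) : False := by
  classical
  -- (1) the parity is quadratic
  have hp : IsDegLeFun 2 (fun x => decide (Odd (u' x))) :=
    stub_walshTower stub_axParity (7 + 7) 6 2 g u' hg hu' (by intro k hk hkn; omega)
  -- (2) the budget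
  have hB : (∑ x, (u' x - 2 * sZ (f x)) ^ 2 : ℤ) ≤ 4096 := by
    have h := fl_budget6 f g u' hu'
    have h' : ((∑ x, (u' x - 2 * sZ (f x)) ^ 2 : ℤ) : ℝ) ≤ 4096 := by rw [h]; nlinarith
    exact_mod_cast h'
  -- (3) Reed–Muller: at least `2¹²` odd points
  obtain ⟨x₁, hx₁⟩ := hodd
  have hRM := bb_rmWeight_holds (7 + 7) 2 (fun x => decide (Odd (u' x))) hp ⟨x₁, decide_eq_true hx₁⟩
  have hPge : 4096 ≤ #(univ.filter fun x : Fin (7 + 7) → Bool => decide (Odd (u' x)) = true) := by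
    have h2 : (2 : ℕ) ^ (7 + 7) = 4 * 4096 := by norm_num
    have h3 : (2 : ℕ) ^ 2 = 4 := by norm_num
    rw [h2, h3] at hRM
    omega
  -- (4) the pointwise cost vanishes
  have hfilt : (univ.filter fun x : Fin (7 + 7) → Bool => decide (Odd (u' x)) = true) = univ.filter fun x => Odd (u' x) :=
    filter_congr fun x _ => by rw [decide_eq_true_iff]
  have hsumP : (∑ x, (if Odd (u' x) then 1 else 0 : ℤ)) = #(univ.filter fun x : Fin (7 + 7) → Bool => Odd (u' x)) := by
    rw [sum_boole]
  have hnonneg : ∀ x, 0 ≤ (u' x - 2 * sZ (f x)) ^ 2 - (if Odd (u' x) then 1 else 0 : ℤ) := by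
    intro x
    split_ifs with h
    · have := tp_res_sq_ge_one (tp_sZ_cases (f x)) h; linarith
    · have := sq_nonneg (u' x - 2 * sZ (f x)); linarith
  have hsum0 : ∑ x, ((u' x - 2 * sZ (f x)) ^ 2 - (if Odd (u' x) then 1 else 0 : ℤ)) = 0 := by
    refine le_antisymm ?_ (sum_nonneg fun x _ => hnonneg x)
    rw [sum_sub_distrib, hsumP, ← hfilt]
    have : (4096 : ℤ) ≤ #(univ.filter fun x : Fin (7 + 7) → Bool => decide (Odd (u' x)) = true) := by exact_mod_cast hPge
    linarith
  have hzero : ∀ x, (u' x - 2 * sZ (f x)) ^ 2 - (if Odd (u' x) then 1 else 0 : ℤ) = 0 :=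
    fun x => (sum_eq_zero_iff_of_nonneg fun y _ => hnonneg y).1 hsum0 x (mem_univ x)
  have hoff : ∀ x, ¬ Odd (u' x) → u' x - 2 * sZ (f x) = 0 := by
    intro x hx
    have h := hzero x
    rw [if_neg hx, sub_zero] at h
    exact (pow_eq_zero_iff two_ne_zero).1 h
  have hon : ∀ x, Odd (u' x) → u' x - 2 * sZ (f x) = 1 ∨ u' x - 2 * sZ (f x) = -1 := by
    intro x hx
    have h := hzero x
    rw [if_pos hx] at h
    have h1 : (u' x - 2 * sZ (f x)) * (u' x - 2 * sZ (f x)) = 1 := by rw [← pow_two]; linarith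
    exact mul_self_eq_one_iff.1 h1
  -- (5) exactly `2¹²` odd points
  have hPcard : #(univ.filter fun x : Fin (7 + 7) → Bool => decide (Odd (u' x)) = true) = 4096 := by
    have hle : (#(univ.filter fun x : Fin (7 + 7) → Bool => Odd (u' x)) : ℤ) ≤ 4096 := by
      rw [← hsumP]
      refine le_trans (sum_le_sum fun x _ => ?_) hB
      split_ifs with h
      · rcases hon x h with h1 | h1 <;> rw [h1] <;> norm_num
      · positivity
    rw [hfilt] at hPge ⊢
    have hle' : #(univ.filter fun x : Fin (7 + 7) → Bool => Odd (u' x)) ≤ 4096 := by exact_mod_cast hle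
    omega
  -- (6) the odd set is a 12-flat
  have hq := qf_flat_of_quadratic (fun x => decide (Odd (u' x))) hp hPcard
  obtain ⟨h0, hadd, hcardV, hcoset⟩ := hq
  set V₀ := univ.filter (fun a : Fin (7 + 7) → Bool => ∀ x, decide (Odd (u' (bxor x a))) = decide (Odd (u' x))) with hV₀
  have hPimg := hcoset x₁ (decide_eq_true hx₁)
  have hmemP : ∀ x, x ∈ (univ.filter fun x : Fin (7 + 7) → Bool => decide (Odd (u' x)) = true) ↔ Odd (u' x) := by
    intro x; simp
  have hin : ∀ z, Odd (u' z) → ∀ c ∈ V₀, Odd (u' (bxor z c)) := by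
    intro z hz c hc
    have h := (mem_filter.1 hc).2 z
    rw [decide_eq_decide] at h
    exact h.2 hz
  have hout : ∀ z, Odd (u' z) → ∀ t, t ∉ V₀ → ¬ Odd (u' (bxor z t)) := by
    intro z hz t ht hzt
    apply ht
    have key := fl_coset_translate V₀ _ x₁ hadd hPimg ((hmemP z).2 hz) h0 t
    rw [bxor_zeroVec] at key
    exact key.1 ((hmemP _).2 hzt)
  -- (7) transversal directions and the flat sum over `x₁ ⊕ ⟨d₁, d₂, c, c'⟩`
  obtain ⟨d₁, d₂, hd₁, hd₂, hd₁₂⟩ := fl_dirs14 V₀ (by rw [hcardV]; norm_num)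
  have hd₂₁ : bxor d₂ d₁ ∉ V₀ := by rwa [bxor_comm] at hd₁₂
  have hmul : ∀ c ∈ V₀, ∀ c' ∈ V₀,
      (u' (bxor x₁ (bxor c c')) - 2 * sZ (f (bxor x₁ (bxor c c')))) * (u' x₁ - 2 * sZ (f x₁)) =
        (u' (bxor x₁ c) - 2 * sZ (f (bxor x₁ c))) * (u' (bxor x₁ c') - 2 * sZ (f (bxor x₁ c'))) := by
    intro c hc c' hc'
    have hu2 : ∀ x, W (fun y => signOf (g y)) x = (2 : ℝ) ^ 5 * ((2 * u' x : ℤ) : ℝ) := by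
      intro x; rw [hu' x]; push_cast; ring
    have h8 := fs_flat_sum_dvd (e := 3) g (fun x => 2 * u' x) hg hu2 x₁
      (Fin.cons d₁ (Fin.cons d₂ (Fin.cons c (Fin.cons c' (fun i : Fin 0 => i.elim0) : Fin 1 → Fin (7 + 7) → Bool)
        : Fin 2 → Fin (7 + 7) → Bool) : Fin 3 → Fin (7 + 7) → Bool) : Fin 4 → Fin (7 + 7) → Bool) (by norm_num)
    -- the sign part: `Σ_ε 4·s(f(pt ε)) ∈ 8ℤ` (sixteen odd terms)
    have hsZ : (8 : ℤ) ∣ ∑ ε : Fin 4 → Bool, 4 * sZ (f (fun j => x₁ j ^^ decide (Odd #(univ.filter fun i : Fin 4 => ε i &&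
        (Fin.cons d₁ (Fin.cons d₂ (Fin.cons c (Fin.cons c' (fun i : Fin 0 => i.elim0) : Fin 1 → Fin (7 + 7) → Bool)
          : Fin 2 → Fin (7 + 7) → Bool) : Fin 3 → Fin (7 + 7) → Bool) : Fin 4 → Fin (7 + 7) → Bool) i j)))) := by
      have e1 : ∀ b : Bool, 4 * sZ b = 4 - 8 * (if b then 1 else 0 : ℤ) := by intro b; cases b <;> simp [sZ]
      simp_rw [e1]
      rw [sum_sub_distrib, sum_const, card_univ, Fintype.card_fun, Fintype.card_bool, Fintype.card_fin, ← mul_sum]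
      exact ⟨8 - ∑ ε : Fin 4 → Bool, (if f (fun j => x₁ j ^^ decide (Odd #(univ.filter fun i : Fin 4 => ε i &&
        (Fin.cons d₁ (Fin.cons d₂ (Fin.cons c (Fin.cons c' (fun i : Fin 0 => i.elim0) : Fin 1 → Fin (7 + 7) → Bool)
          : Fin 2 → Fin (7 + 7) → Bool) : Fin 3 → Fin (7 + 7) → Bool) : Fin 4 → Fin (7 + 7) → Bool) i j))) then 1 else 0 : ℤ),
        by norm_num; ring⟩
    have hδ8 : (8 : ℤ) ∣ ∑ ε : Fin 4 → Bool, (2 * u' (fun j => x₁ j ^^ decide (Odd #(univ.filter fun i : Fin 4 => ε i &&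
        (Fin.cons d₁ (Fin.cons d₂ (Fin.cons c (Fin.cons c' (fun i : Fin 0 => i.elim0) : Fin 1 → Fin (7 + 7) → Bool)
          : Fin 2 → Fin (7 + 7) → Bool) : Fin 3 → Fin (7 + 7) → Bool) : Fin 4 → Fin (7 + 7) → Bool) i j))) -
        4 * sZ (f (fun j => x₁ j ^^ decide (Odd #(univ.filter fun i : Fin 4 => ε i &&
        (Fin.cons d₁ (Fin.cons d₂ (Fin.cons c (Fin.cons c' (fun i : Fin 0 => i.elim0) : Fin 1 → Fin (7 + 7) → Bool)
          : Fin 2 → Fin (7 + 7) → Bool) : Fin 3 → Fin (7 + 7) → Bool) : Fin 4 → Fin (7 + 7) → Bool) i j))))) := by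
      rw [sum_sub_distrib]
      exact dvd_sub h8 hsZ
    simp only [tep_sum_split, Fintype.sum_unique, fl_pt_four, Bool.true_and, Bool.false_and, es_bxor_false,
      show (fun j => c j) = c from rfl, show (fun j => c' j) = c' from rfl, show (fun j => d₁ j) = d₁ from rfl,
      show (fun j => d₂ j) = d₂ from rfl] at hδ8
    -- the four coset points are odd, the twelve translates are even (so `u' = 2s` there)
    have o0 : Odd (u' x₁) := hx₁
    have o1 : Odd (u' (bxor x₁ c')) := hin _ hx₁ c' hc'
    have o2 : Odd (u' (bxor x₁ c)) := hin _ hx₁ c hc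
    have o3 : Odd (u' (bxor (bxor x₁ c') c)) := hin _ o1 c hc
    have zA : ∀ p : Fin (7 + 7) → Bool, Odd (u' p) → 2 * u' (bxor p d₂) - 4 * sZ (f (bxor p d₂)) = 0 := by
      intro p hp'; have := hoff _ (hout p hp' d₂ hd₂); linarith
    have zB : ∀ p : Fin (7 + 7) → Bool, Odd (u' p) → 2 * u' (bxor p d₁) - 4 * sZ (f (bxor p d₁)) = 0 := by
      intro p hp'; have := hoff _ (hout p hp' d₁ hd₁); linarith
    have zC : ∀ p : Fin (7 + 7) → Bool, Odd (u' p) → 2 * u' (bxor (bxor p d₂) d₁) - 4 * sZ (f (bxor (bxor p d₂) d₁)) = 0 := by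
      intro p hp'
      rw [iw_bxor_assoc]
      have := hoff _ (hout p hp' (bxor d₂ d₁) hd₂₁); linarith
    rw [zA _ o0, zA _ o1, zA _ o2, zA _ o3, zB _ o0, zB _ o1, zB _ o2, zB _ o3, zC _ o0, zC _ o1, zC _ o2, zC _ o3] at hδ8
    have h4 : (4 : ℤ) ∣ (u' x₁ - 2 * sZ (f x₁)) + (u' (bxor x₁ c') - 2 * sZ (f (bxor x₁ c'))) +
        (u' (bxor x₁ c) - 2 * sZ (f (bxor x₁ c))) + (u' (bxor (bxor x₁ c') c) - 2 * sZ (f (bxor (bxor x₁ c') c))) := by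
      omega
    have key := fl_signs_of_four_dvd (hon _ o0) (hon _ o1) (hon _ o2) (hon _ o3) h4
    rw [iw_bxor_assoc, bxor_comm c' c] at key
    rw [key, mul_comm]
  -- (8) the `±`character `A = u' − 2(−1)^f` on the coset and its four frequencies
  let A : (Fin (7 + 7) → Bool) → ℝ := fun x => ((u' x - 2 * sZ (f x) : ℤ) : ℝ)
  have hAon : ∀ c₀ ∈ V₀, A (bxor x₁ c₀) = 1 ∨ A (bxor x₁ c₀) = -1 := by
    intro c₀ hc₀
    rcases hon _ (hin _ hx₁ c₀ hc₀) with h | h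
    · left; simp only [A, h]; norm_num
    · right; simp only [A, h]; norm_num
  have hmulA : ∀ c₀ ∈ V₀, ∀ c₀' ∈ V₀, A (bxor x₁ (bxor c₀ c₀')) * A x₁ = A (bxor x₁ c₀) * A (bxor x₁ c₀') := by
    intro c₀ hc₀ c₀' hc₀'
    simp only [A]
    exact_mod_cast hmul c₀ hc₀ c₀' hc₀'
  have hAoff : ∀ x, ¬ Odd (u' x) → A x = 0 := by
    intro x hx; simp only [A, hoff x hx]; norm_num
  have hWA : ∀ y, W A y = 0 ∨ W A y = 4096 ∨ W A y = -4096 := by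
    intro y
    have hsplit : W A y = ∑ c₀ ∈ V₀, A (bxor x₁ c₀) * twist (bxor x₁ c₀) y := by
      unfold W
      rw [← sum_filter_add_sum_filter_not univ (fun x : Fin (7 + 7) → Bool => decide (Odd (u' x)) = true)]
      have hz : ∑ x ∈ univ.filter (fun x : Fin (7 + 7) → Bool => ¬ decide (Odd (u' x)) = true), A x * twist x y = 0 := by
        refine sum_eq_zero fun x hx => ?_
        have hx' : ¬ Odd (u' x) := by simpa using (mem_filter.1 hx).2
        rw [hAoff x hx', zero_mul]
      rw [hz, add_zero, hPimg, sum_image fun a _ b _ hab => by simpa only [bxor_bxor_cancel_left] using congrArg (bxor x₁) hab]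
    obtain ⟨r, hr, hsum⟩ := fl_char_coset V₀ h0 hadd x₁ A hAon hmulA y
    rw [hsplit, hsum, hcardV]
    rcases hr with h | h | h <;> rw [h] <;> norm_num
  -- (9) Parseval for `A`: `Σ_y Â(y)² = 2¹⁴·4096`
  have hPA : ∑ y, W A y ^ 2 = (2 : ℝ) ^ (7 + 7) * 4096 := by
    rw [sum_W_sq]
    congr 1
    have hsq : ∀ x, A x ^ 2 = ((if Odd (u' x) then 1 else 0 : ℤ) : ℝ) := by
      intro x
      by_cases hx : Odd (u' x)
      · rw [if_pos hx]; rcases hon x hx with h | h <;> simp only [A, h] <;> norm_num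
      · rw [if_neg hx, hAoff x hx]; norm_num
    rw [sum_congr rfl fun x _ => hsq x, ← Int.cast_sum, hsumP, ← hfilt, hPcard]
    norm_num
  -- (10) Walsh inversion: `Â = 256(−1)^g − 2 W_f`
  have hinv : ∀ y, ∑ x, (u' x : ℝ) * twist x y = 256 * signOf (g y) := by
    intro y
    have h := tz_inversion (fun z => signOf (g z)) y
    rw [sum_congr rfl fun x _ => by rw [hu' x]] at h
    have e : ∑ x, (2 : ℝ) ^ 6 * (u' x : ℝ) * twist x y = 2 ^ 6 * ∑ x, (u' x : ℝ) * twist x y := by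
      rw [mul_sum]
      exact sum_congr rfl fun x _ => by ring
    rw [e] at h
    have h' : (2 : ℝ) ^ 6 * (∑ x, (u' x : ℝ) * twist x y - 256 * signOf (g y)) = 0 := by
      rw [mul_sub, h]; norm_num; ring
    have h2 : (2 : ℝ) ^ 6 ≠ 0 := by positivity
    linarith [(mul_eq_zero.1 h').resolve_left h2]
  have hFour : ∀ y, W A y = 256 * signOf (g y) - 2 * W (fun x => signOf (f x)) y := by
    intro y
    unfold W
    have e : ∀ x, A x * twist x y = (u' x : ℝ) * twist x y - 2 * (signOf (f x) * twist x y) := by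
      intro x
      simp only [A]
      push_cast
      rw [tp_sZ_cast]
      ring
    rw [sum_congr rfl fun x _ => e x, sum_sub_distrib, ← mul_sum, hinv y]
  -- (11) Parseval for `f` forces a large pairing `Σ (−1)^g Â = 2¹⁷` …
  have hPf := fl_parseval14 f
  have hSg : ∑ y, signOf (g y) * W A y = 131072 := by
    have e : ∀ y, W (fun x => signOf (f x)) y ^ 2 = 16384 - 128 * (signOf (g y) * W A y) + W A y ^ 2 / 4 := by
      intro y
      have hs2 : signOf (g y) ^ 2 = 1 := signOf_sq _
      have hW : W (fun x => signOf (f x)) y = 128 * signOf (g y) - W A y / 2 := by rw [hFour y]; ring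
      rw [hW]
      nlinarith [hs2]
    have hsum := hPf
    rw [sum_congr rfl fun y _ => e y, sum_add_distrib, sum_sub_distrib, sum_const, card_univ, Fintype.card_fun,
      Fintype.card_bool, Fintype.card_fin, nsmul_eq_mul, ← mul_sum, ← sum_div, hPA] at hsum
    set S := ∑ y, signOf (g y) * W A y with hS
    norm_num at hsum
    linarith
  -- (12) … but four frequencies of size `2¹²` pair to at most `2¹⁴`
  have hbound := fl_abs_sum_le (W A) (fun y => signOf (g y)) (by norm_num : (0 : ℝ) < 4096) hWA
    (fun y => by unfold signOf; split_ifs <;> norm_num)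
  rw [hPA, hSg] at hbound
  norm_num at hbound

end Summit.QuantumAdvantage.QuantumAdvantage.Theorems.CubicForrelation.NearExactIsExact

end
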